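import Literature.Probability.Percolation.PlateCrossingEvents
import Literature.Probability.Percolation.LatticeTraceBlocking
import Literature.Probability.Percolation.DualFaceChains
import Literature.Probability.Percolation.BoxCrossingProofs
import Literature.Probability.Percolation.CrossingChains
import Literature.Probability.Percolation.InterfaceLoopClusters
import HarnessLib

/-!
# Plate crossings in a chart: chart room, footprints of drawn traces, middle sites

Topic `Literature/Probability/Percolation`; proofs only.  Metric/lattice bookkeeping for plate
crossing events read through a plane homeomorphism `Φ` (`PlateCrossingEvents.lean`), as used by
transfer arguments between percolation models whose loop ensembles are close (Camia–Newman,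
CMP 268 (2006), §5; DKKMO arXiv:2012.11672 §5.2):

* `exists_chart_room_symm'` — uniform continuity of `Φ⁻¹` near the compact `Φ(plateBox 2 2)`
  ("chart room"), `chart_coords_near`, `mem_plateBox_iff_abs`, `plateBox_subset_two`;
* `exists_unitStepPath_of_walk` — a lattice walk read as a unit-step path `v (j+1) = v j + u_{d j}`;
* `exists_mem_support_small_pos` — discrete intermediate value along a walk (a site of a crossing
  walk within one step of the middle line of the chart);
* `dist_meshPoint_adj`, `dist_dualDraw_adj`, `dist_dualDraw_meshPoint_le`;
* `symm_meshTrace_subset`, `symm_dualTrace_subset` — the chart footprint of the mesh trace of a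
  plate walk and of the planar dual trace of a plate walk of faces.

## References

* F. Camia, C. M. Newman, Comm. Math. Phys. 268 (2006), §5 [CamiaNewman2006].
-/

noncomputable section

namespace Literature.Probability.Percolation

open Literature.Probability.RandomPlanarGeometry
open Literature.Probability.LatticeModels
open Filter Topology Set Metric Complex

/-! ## Chart room -/

/-- `plateBox` is compact. [folklore] -/
theorem isCompact_plateBox (x y : ℝ) : IsCompact (plateBox x y) :=
  isCompact_Icc.reProdIm isCompact_Icc

/-- Membership in `plateBox` through absolute values. [folklore] -/
theorem mem_plateBox_iff_abs {x y : ℝ} {z : ℂ} : z ∈ plateBox x y ↔ |z.re| ≤ x ∧ |z.im| ≤ y := by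
  rw [plateBox, mem_reProdIm, mem_Icc, mem_Icc, abs_le, abs_le]

/-- **Chart room, backward**: for every `ν > 0` there is `ρ ∈ (0, 1]` such that a point within
`ρ` of the image of a point of `plateBox 2 2` pulls back to within `ν` of it (uniform continuity of
`Φ⁻¹` on the compact `1`-thickening of `Φ(plateBox 2 2)`). [folklore] -/
theorem exists_chart_room_symm' (Φ : ℂ ≃ₜ ℂ) {ν : ℝ} (hν : 0 < ν) :
    ∃ ρ : ℝ, 0 < ρ ∧ ρ ≤ 1 ∧ ∀ z ∈ plateBox 2 2, ∀ p : ℂ, dist p (Φ z) ≤ ρ → dist (Φ.symm p) z ≤ ν := by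
  set K : Set ℂ := cthickening 1 (Φ '' plateBox 2 2) with hK
  have hKc : IsCompact K := ((isCompact_plateBox 2 2).image Φ.continuous).cthickening
  have huc : UniformContinuousOn Φ.symm K := hKc.uniformContinuousOn_of_continuous Φ.symm.continuous.continuousOn
  obtain ⟨ρ, hρ, h⟩ := Metric.uniformContinuousOn_iff_le.1 huc ν hν
  refine ⟨min ρ 1, lt_min hρ one_pos, min_le_right _ _, fun z hz p hp ↦ ?_⟩
  have hΦz : Φ z ∈ K := self_subset_cthickening _ (mem_image_of_mem Φ hz)
  have hpK : p ∈ K := mem_cthickening_of_dist_le p (Φ z) 1 _ (mem_image_of_mem Φ hz) (hp.trans (min_le_right _ _))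
  have := h p hpK (Φ z) hΦz (hp.trans (min_le_left _ _))
  rwa [Homeomorph.symm_apply_apply] at this

/-- The coordinates of two complex numbers differ by at most their distance. [folklore] -/
theorem abs_re_sub_le_dist_chart (z w : ℂ) : |z.re - w.re| ≤ dist z w := by
  rw [dist_eq_norm, ← sub_re]; exact abs_re_le_norm _

/-- The coordinates of two complex numbers differ by at most their distance. [folklore] -/
theorem abs_im_sub_le_dist_chart (z w : ℂ) : |z.im - w.im| ≤ dist z w := by
  rw [dist_eq_norm, ← sub_im]; exact abs_im_le_norm _

/-- **Chart reading of a nearby point**: under the chart room `hroom`, a point `p` within `ρ` of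
`Φ z` (`z ∈ plateBox 2 2`) has chart coordinates within `ν` of those of `z`. [folklore] -/
theorem chart_coords_near {Φ : ℂ ≃ₜ ℂ} {ν ρ : ℝ}
    (hroom : ∀ z ∈ plateBox 2 2, ∀ p : ℂ, dist p (Φ z) ≤ ρ → dist (Φ.symm p) z ≤ ν)
    {z : ℂ} (hz : z ∈ plateBox 2 2) {p : ℂ} (hp : dist p (Φ z) ≤ ρ) :
    |(Φ.symm p).re - z.re| ≤ ν ∧ |(Φ.symm p).im - z.im| ≤ ν :=
  ⟨(abs_re_sub_le_dist_chart _ _).trans (hroom z hz p hp), (abs_im_sub_le_dist_chart _ _).trans (hroom z hz p hp)⟩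

/-- A plate box inside the big box. [folklore] -/
theorem plateBox_subset_two {a b : ℝ} (ha : a ≤ 2) (hb : b ≤ 2) : plateBox a b ⊆ plateBox 2 2 := by
  intro z hz
  rw [mem_plateBox_iff_abs] at hz ⊢
  exact ⟨hz.1.trans ha, hz.2.trans hb⟩

/-- Points of the image of a set pull back into the set. [folklore] -/
theorem symm_mem_of_mem_image {Φ : ℂ ≃ₜ ℂ} {S : Set ℂ} {p : ℂ} (hp : p ∈ Φ '' S) : Φ.symm p ∈ S := by
  obtain ⟨z, hz, rfl⟩ := hp
  rwa [Homeomorph.symm_apply_apply]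

/-- A point is the image of its pull-back. [folklore] -/
theorem mem_image_of_symm_mem {Φ : ℂ ≃ₜ ℂ} {S : Set ℂ} {p : ℂ} (hp : Φ.symm p ∈ S) : p ∈ Φ '' S :=
  ⟨Φ.symm p, hp, Φ.apply_symm_apply p⟩

/-! ## Lattice walks as unit-step paths -/

/-- **A lattice walk read as a unit-step path** `v 0, …, v m` with `v (j+1) = v j + cornerUnit (d j)`,
through the support of the walk. [folklore] -/
theorem exists_unitStepPath_of_walk {a b : Site 2} (W : (zdGraph 2).Walk a b) :
    ∃ (v : ℕ → Site 2) (d : ℕ → Fin 4) (m : ℕ), v 0 = a ∧ v m = b ∧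
      (∀ j < m, v (j + 1) = v j + cornerUnit (d j)) ∧ ∀ j ≤ m, v j ∈ W.support := by
  classical
  refine ⟨fun j ↦ W.getVert j, fun j ↦ if h : j < W.length then
      Classical.choose (exists_eq_add_cornerUnit (W.adj_getVert_succ h)) else 0, W.length,
    W.getVert_zero, W.getVert_length, fun j hj ↦ ?_, fun j _ ↦ W.getVert_mem_support j⟩
  simp only [dif_pos hj]
  exact Classical.choose_spec (exists_eq_add_cornerUnit (W.adj_getVert_succ hj))

/-! ## A site of a crossing walk near the middle line -/

/-- **Discrete intermediate value along a walk**: if a real function on sites is `≤ 0` at the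
start of a walk, `> 0` at its end, and changes by at most `ν` across every lattice edge at a site
of the walk, then some site of the walk has value in `(0, ν]`. [folklore] -/
theorem exists_mem_support_small_pos {a b : Site 2} (W : (zdGraph 2).Walk a b) (φ : Site 2 → ℝ) {ν : ℝ}
    (ha : φ a ≤ 0) (hb : 0 < φ b) (hν : ∀ z ∈ W.support, ∀ v : Site 2, (zdGraph 2).Adj v z → |φ v - φ z| ≤ ν) :
    ∃ z ∈ W.support, 0 < φ z ∧ φ z ≤ ν := by
  classical
  obtain ⟨z, q, hz, hsupp, -, -, hlast⟩ := exists_walk_until (G := zdGraph 2) (fun v : Site 2 ↦ 0 < φ v) W hb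
  have hzW : z ∈ W.support := hsupp z q.end_mem_support
  rcases hlast with rfl | ⟨v, hvz, hv⟩
  · exact absurd hz (not_lt.2 ha)
  · refine ⟨z, hzW, hz, ?_⟩
    have h1 := hν z hzW v hvz
    rw [not_lt] at hv
    have := (abs_le.1 h1).1
    linarith

/-! ## Adjacent sites and faces in the chart -/

/-- Adjacent sites are at distance `δ` (`δ > 0`). [folklore] -/
theorem dist_meshPoint_adj {δ : ℝ} (hδ : 0 < δ) {x y : Site 2} (h : (zdGraph 2).Adj x y) :
    dist (meshPoint δ x) (meshPoint δ y) = δ := by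
  rw [dist_meshPoint_of_adj h, abs_of_pos hδ]

/-- Dual positions of adjacent faces are at distance `δ` (`δ > 0`). [folklore] -/
theorem dist_dualDraw_adj {δ : ℝ} (hδ : 0 < δ) {f g : Site 2} (h : (zdGraph 2).Adj f g) :
    dist (dualDraw δ f) (dualDraw δ g) = δ := by
  simp only [dualDraw, dualScale_toComplex]
  rw [dist_add_right, dist_meshPoint_of_adj h, abs_of_pos hδ]

/-- The dual position of a face is within `δ` of its lower-left corner (`δ ≥ 0`). [folklore] -/
theorem dist_dualDraw_meshPoint_le {δ : ℝ} (hδ : 0 ≤ δ) (f : Site 2) : dist (dualDraw δ f) (meshPoint δ f) ≤ δ := by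
  simp only [dualDraw, dualScale_toComplex]
  rw [dist_eq_norm, add_sub_cancel_left, norm_mul, Complex.norm_real, Real.norm_of_nonneg hδ]
  have hoff : ‖dualOffset‖ ≤ 1 := by
    refine (norm_le_abs_re_add_abs_im _).trans ?_
    have hre : dualOffset.re = 1 / 2 := rfl
    have him : dualOffset.im = 1 / 2 := rfl
    rw [hre, him]; norm_num
  calc δ * ‖dualOffset‖ ≤ δ * 1 := by gcongr
    _ = δ := mul_one δ

/-! ## The chart footprint of the drawn traces of plate crossings -/

/-- **Chart footprint of the mesh trace of a plate walk**: if every site of the walk is drawn in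
`Φ(plateBox a b)` (`a, b ≤ 2`) and `δ ≤ ρ`, then every point of its mesh trace pulls back into
`plateBox (a + ν) (b + ν)`. [folklore] -/
theorem symm_meshTrace_subset {Φ : ℂ ≃ₜ ℂ} {ν ρ δ : ℝ} (hδ : 0 < δ) (hδρ : δ ≤ ρ)
    (hroom : ∀ z ∈ plateBox 2 2, ∀ p : ℂ, dist p (Φ z) ≤ ρ → dist (Φ.symm p) z ≤ ν)
    {a b : ℝ} (ha : a ≤ 2) (hb : b ≤ 2) {u v : Site 2} {W : (zdGraph 2).Walk u v}
    (hW : ∀ x ∈ W.support, meshPoint δ x ∈ Φ '' plateBox a b) {p : ℂ} (hp : p ∈ meshTrace δ W) :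
    Φ.symm p ∈ plateBox (a + ν) (b + ν) := by
  obtain ⟨x, hx, hdist⟩ := exists_dist_meshPoint_le_of_mem_meshTrace hp
  rw [abs_of_pos hδ] at hdist
  have hz := symm_mem_of_mem_image (hW x hx)
  have hxz : meshPoint δ x = Φ (Φ.symm (meshPoint δ x)) := (Φ.apply_symm_apply _).symm
  have hnear := chart_coords_near hroom (plateBox_subset_two ha hb hz) (p := p) (by rw [← hxz]; exact hdist.trans hδρ)
  rw [mem_plateBox_iff_abs] at hz ⊢
  constructor
  · have := abs_sub_abs_le_abs_sub (Φ.symm p).re (Φ.symm (meshPoint δ x)).re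
    linarith [hnear.1, hz.1]
  · have := abs_sub_abs_le_abs_sub (Φ.symm p).im (Φ.symm (meshPoint δ x)).im
    linarith [hnear.2, hz.2]

/-- **Chart footprint of the planar dual trace of a plate walk of faces** (faces drawn by
`dualDraw δ` in `Φ(plateBox a b)`, `a, b ≤ 2`, `δ ≤ ρ`). [folklore] -/
theorem symm_dualTrace_subset {Φ : ℂ ≃ₜ ℂ} {ν ρ δ : ℝ} (hδ : 0 < δ) (hδρ : δ ≤ ρ)
    (hroom : ∀ z ∈ plateBox 2 2, ∀ p : ℂ, dist p (Φ z) ≤ ρ → dist (Φ.symm p) z ≤ ν)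
    {a b : ℝ} (ha : a ≤ 2) (hb : b ≤ 2) {f g : Site 2} {W : (zdGraph 2).Walk f g}
    (hW : ∀ x ∈ W.support, dualDraw δ x ∈ Φ '' plateBox a b) {p : ℂ} (hp : p ∈ dualScale δ '' walkTrace W) :
    Φ.symm p ∈ plateBox (a + ν) (b + ν) := by
  obtain ⟨x, hx, hdist⟩ := exists_dist_dualScale_le_of_mem_image_walkTrace hδ.le hp
  have hz := symm_mem_of_mem_image (hW x hx)
  have hxz : dualDraw δ x = Φ (Φ.symm (dualDraw δ x)) := (Φ.apply_symm_apply _).symm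
  have hdist' : dist p (Φ (Φ.symm (dualDraw δ x))) ≤ ρ := by
    rw [← hxz]; exact hdist.trans hδρ
  have hnear := chart_coords_near hroom (plateBox_subset_two ha hb hz) hdist'
  rw [mem_plateBox_iff_abs] at hz ⊢
  constructor
  · have := abs_sub_abs_le_abs_sub (Φ.symm p).re (Φ.symm (dualDraw δ x)).re
    linarith [hnear.1, hz.1]
  · have := abs_sub_abs_le_abs_sub (Φ.symm p).im (Φ.symm (dualDraw δ x)).im
    linarith [hnear.2, hz.2]


end Literature.Probability.Percolation

end
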